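import Summits.ResolutionOfSingularities.ResolutionOfSingularities.Theorems.FrobeniusLadderFInjectiveMacaulayficationKLocCellKit
import Summits.ResolutionOfSingularities.ResolutionOfSingularities.Theorems.FrobeniusLadderFInjectiveMacaulayficationQ6CNKit
import HarnessLib

/-!
# Soundness of the `KLocCell` certificate kit (crux `FInjectiveMacaulayfication`, road B / G2–G3)

[OURS · L1 W4.5a] Support file for crux stmt-ResolutionOfSingularities-15315 (seat table v13, stub-6; R12.11(d) / R12.12(b)).  Soundness of
the computable list programs of `KLocCellKit` into `MvPolynomial (Fin n) K`: `evalK_shiftK`, `evalK_collectK`, `mergeFK_perm`,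
`evalK_mulK`, `evalK_powK`, `evalK_expandK`, `evalK_splitK` (the residue split `Σ_α Y^α · expand p s_α`), `splitK_inv` (`α < p`, stored keys
honest), `splitK_nodup`, `evalK_cofactorNFK`; and the packaged theorems **`klocCell_of_check`** / **`klocCells_of_check`**: from
`checkK p G S R T T₀ = true` (resp. `checkKs p G cells = true`) — ONE `decide` — the per-stratum binder of `L/w45a/ToricCertSig.lean`
v1.2 §3 (`KLocCell`, typed by res-L1-w45a-stub-1): `∃ L rr t t₀, (L.map Prod.fst).Nodup ∧ (∀ e ∈ L, ∀ i, e.1 i < p) ∧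
g ^ (p - 1) = (L.map fun e => monomial e.1 1 * expand p e.2).sum ∧ 1 = (zipWith (fun r e => r * expand p e.2) rr L).sum +
Σ_{i ∈ S} t i * X i + t₀ * g` VERBATIM, for `g = KLocCellKit.evalL K G` (resp. for every `S` of the chart's cell list).
No definition is declared; AI-written, weaker than expert review; no statement of [claim: Hironaka2017] is used. [folklore]
-/

-- single-problem summit: the doubled namespace component is forced
set_option linter.dupNamespace false

noncomputable section

namespace Summit.ResolutionOfSingularities.ResolutionOfSingularities.Theorems.FInjectiveMacaulayfication.KLocCellKit

open MvPolynomial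

variable {n : ℕ} (K : Type) [Field K]

/-- Unfolding `evalK` on `cons`. [folklore] -/
theorem evalK_cons (t : ℤ × ℕ × (Fin n → ℕ)) (L : List (ℤ × ℕ × (Fin n → ℕ))) :
    evalK K (t :: L) = monomial (Finsupp.equivFunOnFinite.symm t.2.2) ((t.1 : ℤ) : K) + evalK K L := by
  simp [evalK]

/-- `evalK [] = 0`. [folklore] -/
theorem evalK_nil : evalK K ([] : List (ℤ × ℕ × (Fin n → ℕ))) = 0 := by simp [evalK]

/-- `evalK` is additive in the list. [folklore] -/
theorem evalK_append (L M : List (ℤ × ℕ × (Fin n → ℕ))) : evalK K (L ++ M) = evalK K L + evalK K M := by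
  simp [evalK]

/-- Keys do not matter: `evalK (withKey L) = evalL L`. [folklore] -/
theorem evalK_withKey (L : List (ℤ × (Fin n → ℕ))) : evalK K (withKey L) = evalL K L := by
  simp [evalK, evalL, withKey, Function.comp_def]

/-- The constant keyed term `(1, 0, 0)` has value `1`. [folklore] -/
theorem monomial_symm_zero : (monomial (Finsupp.equivFunOnFinite.symm (0 : Fin n → ℕ)) (1 : K) : MvPolynomial (Fin n) K) = 1 := by
  rw [show (Finsupp.equivFunOnFinite.symm (0 : Fin n → ℕ) : Fin n →₀ ℕ) = 0 from by ext; simp, monomial_zero', C_1]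

/-- Soundness of `shiftK`. [folklore] -/
theorem evalK_shiftK (s : ℤ × ℕ × (Fin n → ℕ)) (L : List (ℤ × ℕ × (Fin n → ℕ))) :
    evalK K (shiftK s L) = monomial (Finsupp.equivFunOnFinite.symm s.2.2) ((s.1 : ℤ) : K) * evalK K L := by
  induction L with
  | nil => simp [shiftK, evalK]
  | cons t L ih =>
    simp only [shiftK, List.map_cons] at ih ⊢
    rw [evalK_cons, evalK_cons, mul_add, ← ih, monomial_mul, Q6CNKit.symm_add, Int.cast_mul]

/-- Soundness of `collectK`. [folklore] -/
theorem evalK_collectK (L : List (ℤ × ℕ × (Fin n → ℕ))) : evalK K (collectK L) = evalK K L := by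
  induction L with
  | nil => rfl
  | cons t L ih =>
    rw [evalK_cons, ← ih]
    rcases hc : collectK L with _ | ⟨t', L'⟩
    · simp only [collectK, hc, evalK_cons]
    · simp only [collectK, hc]
      by_cases h : t.2.1 = t'.2.1 ∧ t.2.2 = t'.2.2
      · rw [if_pos h, evalK_cons, evalK_cons, h.2, Int.cast_add, map_add, add_assoc]
      · rw [if_neg h, evalK_cons]

/-- `mergeFK` is a permutation of the concatenation. [folklore] -/
theorem mergeFK_perm : ∀ (f : ℕ) (L M : List (ℤ × ℕ × (Fin n → ℕ))), (mergeFK f L M).Perm (L ++ M)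
  | 0, L, M => by simp [mergeFK]
  | _ + 1, [], M => by simp [mergeFK]
  | _ + 1, t :: L, [] => by simp [mergeFK]
  | f + 1, t :: L, t' :: M => by
    simp only [mergeFK]
    split_ifs
    · exact (mergeFK_perm f L (t' :: M)).cons t
    · refine ((mergeFK_perm f (t :: L) M).cons t').trans ?_
      simpa using (List.perm_middle (a := t') (l₁ := t :: L) (l₂ := M)).symm

/-- Soundness of `mergeFK`. [folklore] -/
theorem evalK_mergeFK (f : ℕ) (L M : List (ℤ × ℕ × (Fin n → ℕ))) : evalK K (mergeFK f L M) = evalK K L + evalK K M := by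
  rw [← evalK_append]
  exact ((mergeFK_perm f L M).map _).sum_eq

/-- Soundness of `mulK`. [folklore] -/
theorem evalK_mulK (A B : List (ℤ × ℕ × (Fin n → ℕ))) : evalK K (mulK A B) = evalK K A * evalK K B := by
  induction A with
  | nil => simp [mulK, evalK]
  | cons s A ih =>
    simp only [mulK, List.foldr_cons] at ih ⊢
    rw [evalK_collectK, evalK_mergeFK, evalK_shiftK, ih, evalK_cons, add_mul]

/-- Soundness of `powK`. [folklore] -/
theorem evalK_powK (G : List (ℤ × ℕ × (Fin n → ℕ))) : ∀ m : ℕ, evalK K (powK G m) = evalK K G ^ m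
  | 0 => by
    simp only [powK, evalK, List.map_cons, List.map_nil, List.sum_cons, List.sum_nil, add_zero, pow_zero, Int.cast_one]
    exact monomial_symm_zero K
  | m + 1 => by rw [powK, evalK_mulK, evalK_powK G m, pow_succ, mul_comm]

/-- Soundness of `expandK`. [folklore] -/
theorem evalK_expandK (p : ℕ) (L : List (ℤ × ℕ × (Fin n → ℕ))) : evalK K (expandK p L) = expand p (evalK K L) := by
  induction L with
  | nil => simp [expandK, evalK]
  | cons t L ih =>
    simp only [expandK, List.map_cons] at ih ⊢
    have he : (Finsupp.equivFunOnFinite.symm (p • t.2.2) : Fin n →₀ ℕ) = p • Finsupp.equivFunOnFinite.symm t.2.2 := by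
      ext i; simp
    rw [evalK_cons, evalK_cons, map_add, ← ih, expand_monomial, he]

/-- Soundness of `addNFK`. [folklore] -/
theorem evalK_addNFK (P acc : List (ℤ × ℕ × (Fin n → ℕ))) : evalK K (addNFK P acc) = evalK K P + evalK K acc := by
  rw [addNFK, evalK_collectK, evalK_mergeFK]

/-- The value of the split groups in the currency of `ToricCertSig` §2 after one insertion. [folklore] -/
theorem evalK_splitInsK (p : ℕ) (kα : ℕ) (α : Fin n → ℕ) (q : ℤ × ℕ × (Fin n → ℕ)) :
    ∀ gs : List (ℕ × (Fin n → ℕ) × List (ℤ × ℕ × (Fin n → ℕ))),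
    (((splitInsK kα α q gs).map fun g => (monomial (Finsupp.equivFunOnFinite.symm g.2.1) (1 : K) : MvPolynomial (Fin n) K) *
        expand p (evalK K g.2.2)).sum) =
      monomial (Finsupp.equivFunOnFinite.symm α) (1 : K) * expand p (evalK K [q]) +
        ((gs.map fun g => (monomial (Finsupp.equivFunOnFinite.symm g.2.1) (1 : K) : MvPolynomial (Fin n) K) *
          expand p (evalK K g.2.2)).sum)
  | [] => by simp [splitInsK]
  | g :: gs => by
    simp only [splitInsK]
    split_ifs with h1 h2
    · rw [List.map_cons, List.map_cons, List.sum_cons, List.sum_cons, h1.2, evalK_cons, evalK_cons, evalK_nil, add_zero,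
        map_add, mul_add, add_assoc]
    · rw [List.map_cons, List.sum_cons]
    · rw [List.map_cons, List.map_cons, List.sum_cons, List.sum_cons, evalK_splitInsK p kα α q gs, add_left_comm]

/-- **Soundness of the residue split**: `evalK L = Σ_{(k, α, s) ∈ splitK p L} Y^α · expand p (evalK s)`. [folklore] -/
theorem evalK_splitK (p : ℕ) (L : List (ℤ × ℕ × (Fin n → ℕ))) :
    evalK K L = (((splitK p L).map fun g => (Finsupp.equivFunOnFinite.symm g.2.1, evalK K g.2.2)).map
      fun e : (Fin n →₀ ℕ) × MvPolynomial (Fin n) K => monomial e.1 (1 : K) * expand p e.2).sum := by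
  rw [List.map_map]
  induction L with
  | nil => simp [splitK, evalK]
  | cons t L ih =>
    simp only [splitK, List.foldr_cons] at ih ⊢
    rw [evalK_cons, ih]
    have h := evalK_splitInsK K p (key fun i => t.2.2 i % p) (fun i => t.2.2 i % p)
      (t.1, key fun i => t.2.2 i / p, fun i => t.2.2 i / p)
      (List.foldr (fun t gs => splitInsK (key fun i => t.2.2 i % p) (fun i => t.2.2 i % p)
        (t.1, key fun i => t.2.2 i / p, fun i => t.2.2 i / p) gs) [] L)
    simp only [Function.comp_def] at h ⊢
    have he : (Finsupp.equivFunOnFinite.symm t.2.2 : Fin n →₀ ℕ) =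
        Finsupp.equivFunOnFinite.symm (fun i => t.2.2 i % p) + p • Finsupp.equivFunOnFinite.symm (fun i => t.2.2 i / p) := by
      ext i
      simp only [Finsupp.coe_add, Pi.add_apply, Finsupp.coe_equivFunOnFinite_symm, Finsupp.coe_smul, Pi.smul_apply,
        smul_eq_mul]
      exact (Nat.mod_add_div (t.2.2 i) p).symm
    rw [h, evalK_cons, evalK_nil, add_zero, expand_monomial, monomial_mul, one_mul, ← he]

/-- Invariants of the split groups: stored key = key of the residue, and residues `< p` (`0 < p`). [folklore] -/
theorem splitK_inv (p : ℕ) (hp : 0 < p) (L : List (ℤ × ℕ × (Fin n → ℕ))) :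
    ∀ g ∈ splitK p L, g.1 = key g.2.1 ∧ ∀ i : Fin n, g.2.1 i < p := by
  induction L with
  | nil => simp [splitK]
  | cons t L ih =>
    simp only [splitK, List.foldr_cons] at ih ⊢
    generalize (List.foldr (fun t gs => splitInsK (key fun i => t.2.2 i % p) (fun i => t.2.2 i % p)
        (t.1, key fun i => t.2.2 i / p, fun i => t.2.2 i / p) gs) [] L) = gs at ih ⊢
    have hlt : ∀ i : Fin n, (fun i => t.2.2 i % p) i < p := fun i => Nat.mod_lt _ hp
    generalize (fun i => t.2.2 i % p) = α at hlt ⊢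
    obtain ⟨kα, hk⟩ : ∃ kα, kα = key α := ⟨_, rfl⟩
    rw [← hk]
    have hα : kα = key α ∧ ∀ i : Fin n, α i < p := ⟨hk, hlt⟩
    generalize ((t.1, key fun i => t.2.2 i / p, fun i => t.2.2 i / p) : ℤ × ℕ × (Fin n → ℕ)) = q
    induction gs with
    | nil => simpa [splitInsK] using hα
    | cons g gs ih2 =>
      simp only [splitInsK]
      split_ifs
      · intro g' hg'
        rcases List.mem_cons.mp hg' with rfl | h
        · exact ih g (by simp)
        · exact ih g' (by simp [h])
      · intro g' hg'
        rcases List.mem_cons.mp hg' with rfl | h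
        · exact hα
        · exact ih g' h
      · intro g' hg'
        rcases List.mem_cons.mp hg' with rfl | h
        · exact ih g' (by simp)
        · exact ih2 (fun x hx => ih x (by simp [hx])) g' h

/-- `pwDistinct` decides pairwise distinctness. [folklore] -/
theorem pairwise_of_pwDistinct : ∀ l : List ℕ, pwDistinct l = true → l.Pairwise (· ≠ ·)
  | [], _ => List.Pairwise.nil
  | k :: ks, h => by
    simp only [pwDistinct, Bool.and_eq_true, List.all_eq_true, bne_iff_ne, ne_eq] at h
    exact List.Pairwise.cons (fun k' hk' heq => h.1 k' hk' heq.symm) (pairwise_of_pwDistinct ks h.2)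

/-- Distinct stored keys give a `Nodup` residue list. [folklore] -/
theorem splitK_nodup (p : ℕ) (hp : 0 < p) (L : List (ℤ × ℕ × (Fin n → ℕ)))
    (h : ((splitK p L).map fun g => g.1).Pairwise (· ≠ ·)) :
    (((splitK p L).map fun g => ((Finsupp.equivFunOnFinite.symm g.2.1 : Fin n →₀ ℕ), evalK K g.2.2)).map Prod.fst).Nodup := by
  rw [List.map_map, List.Nodup, List.pairwise_map]
  rw [List.pairwise_map] at h
  refine h.imp_of_mem fun {a b} ha hb hab heq => hab ?_
  simp only [Function.comp_apply] at heq
  rw [(splitK_inv p hp L a ha).1, (splitK_inv p hp L b hb).1, Finsupp.equivFunOnFinite.symm.injective heq]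

/-- `zipWith` of two maps of one list. [folklore] -/
theorem zipWith_map_map {α β γ δ : Type} (f : β → γ → δ) (g : α → β) (h : α → γ) (l : List α) :
    List.zipWith f (l.map g) (l.map h) = l.map fun x => f (g x) (h x) := by
  induction l with
  | nil => rfl
  | cons a l ih => simp [ih]

/-- The value of the keyed variable term is `Y_i`. [folklore] -/
theorem evalK_single (i : Fin n) :
    evalK K [((1 : ℤ), key (Pi.single i 1 : Fin n → ℕ), (Pi.single i 1 : Fin n → ℕ))] = X i := by
  rw [evalK_cons, evalK_nil, add_zero, Int.cast_one, X]
  congr 1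
  ext j
  simp

/-- Soundness of `lookupRK` is not needed: its value is whatever it is.  Soundness of the cofactor normal form. [folklore] -/
theorem evalK_cofactorNFK (p : ℕ) (GK : List (ℤ × ℕ × (Fin n → ℕ))) (S : Finset (Fin n))
    (gs : List (ℕ × (Fin n → ℕ) × List (ℤ × ℕ × (Fin n → ℕ)))) (R : List ((Fin n → ℕ) × List (ℤ × (Fin n → ℕ))))
    (T : Fin n → List (ℤ × (Fin n → ℕ))) (T₀ : List (ℤ × (Fin n → ℕ))) :
    evalK K (cofactorNFK p GK S gs R T T₀) =
      (List.zipWith (fun r e => r * expand p e.2) (gs.map fun g => evalK K (lookupRK R g.1 g.2.1))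
          (gs.map fun g => ((Finsupp.equivFunOnFinite.symm g.2.1 : Fin n →₀ ℕ), evalK K g.2.2))).sum +
        ∑ i ∈ S, evalL K (T i) * X i + evalL K T₀ * evalK K GK - 1 := by
  rw [zipWith_map_map]
  have h1 : evalK K (gs.foldr (fun g acc => addNFK (mulK (lookupRK R g.1 g.2.1) (expandK p g.2.2)) acc) []) =
      (gs.map fun g => evalK K (lookupRK R g.1 g.2.1) * expand p (evalK K g.2.2)).sum := by
    induction gs with
    | nil => simp [evalK]
    | cons g gs ih => rw [List.foldr_cons, evalK_addNFK, ih, evalK_mulK, evalK_expandK, List.map_cons, List.sum_cons]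
  have h2 : ∀ acc : List (ℤ × ℕ × (Fin n → ℕ)),
      evalK K ((List.finRange n).foldr
        (fun i acc => if i ∈ S then
          addNFK (mulK (withKey (T i)) [(1, key (Pi.single i 1 : Fin n → ℕ), Pi.single i 1)]) acc else acc) acc) =
        ∑ i ∈ S, evalL K (T i) * X i + evalK K acc := by
    intro acc
    have h3 : ∀ l : List (Fin n),
        evalK K (l.foldr
          (fun i acc => if i ∈ S then
            addNFK (mulK (withKey (T i)) [(1, key (Pi.single i 1 : Fin n → ℕ), Pi.single i 1)]) acc else acc) acc) =
          (l.map fun i => if i ∈ S then evalL K (T i) * X i else 0).sum + evalK K acc := by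
      intro l
      induction l with
      | nil => simp
      | cons i l ih =>
        rw [List.foldr_cons, List.map_cons, List.sum_cons]
        split_ifs with hi
        · rw [evalK_addNFK, ih, evalK_mulK, evalK_single, evalK_withKey, add_assoc]
        · rw [ih, zero_add]
    rw [h3, ← Fin.sum_univ_def, Finset.sum_ite_mem, Finset.univ_inter]
  rw [cofactorNFK, evalK_addNFK, evalK_addNFK, h2, h1, evalK_mulK, evalK_withKey, evalK_cons, evalK_nil]
  simp only [Int.cast_neg, Int.cast_one, add_zero, map_neg]
  rw [monomial_symm_zero K]
  ring

/-- A keyed term list all of whose coefficients are divisible by `p` vanishes in characteristic `p`. [folklore] -/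
theorem evalK_eq_zero_of_dvd (p : ℕ) [CharP K p] (L : List (ℤ × ℕ × (Fin n → ℕ))) (h : ∀ t ∈ L, (p : ℤ) ∣ t.1) :
    evalK K L = 0 := by
  induction L with
  | nil => rfl
  | cons t L ih =>
    rw [evalK_cons, ih (fun t' ht' => h t' (List.mem_cons_of_mem _ ht')), add_zero,
      (CharP.intCast_eq_zero_iff K p t.1).mpr (h t (by simp)), map_zero]

/-- **THE G2 CELL FROM ONE KERNEL CHECK.**  For a chart polynomial given as a term list `G` (`g = evalL K G`), a stratum `S`,
cofactor data `R` (per residue), `T` (per variable of `S`) and `T₀`: if `checkK p G S R T T₀ = true` (one `decide`: distinct residue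
keys of the computed split of `g^(p-1)`, and the cofactor normal form vanishes mod `p`), then the per-stratum binder of
`ToricCertSig` §3 / `KLocCell` holds VERBATIM: `∃ L rr t t₀, (L.map Prod.fst).Nodup ∧ (∀ e ∈ L, ∀ i, e.1 i < p) ∧
g ^ (p - 1) = (L.map fun e => monomial e.1 1 * expand p e.2).sum ∧ 1 = (zipWith (fun r e => r * expand p e.2) rr L).sum +
Σ_{i ∈ S} t i * X i + t₀ * g`. [folklore] -/
theorem klocCell_of_check (p : ℕ) [Fact p.Prime] [CharP K p] (G : List (ℤ × (Fin n → ℕ))) (S : Finset (Fin n))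
    (R : List ((Fin n → ℕ) × List (ℤ × (Fin n → ℕ)))) (T : Fin n → List (ℤ × (Fin n → ℕ))) (T₀ : List (ℤ × (Fin n → ℕ)))
    (hcheck : checkK p G S R T T₀ = true) :
    ∃ (L : List ((Fin n →₀ ℕ) × MvPolynomial (Fin n) K)) (rr : List (MvPolynomial (Fin n) K))
      (t : Fin n → MvPolynomial (Fin n) K) (t₀ : MvPolynomial (Fin n) K),
      (L.map Prod.fst).Nodup ∧ (∀ e ∈ L, ∀ i : Fin n, e.1 i < p) ∧
      evalL K G ^ (p - 1) = (L.map fun e => MvPolynomial.monomial e.1 (1 : K) * MvPolynomial.expand p e.2).sum ∧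
      (1 : MvPolynomial (Fin n) K) = (List.zipWith (fun r e => r * MvPolynomial.expand p e.2) rr L).sum +
        ∑ i ∈ S, t i * MvPolynomial.X i + t₀ * evalL K G := by
  have hp : 0 < p := (Fact.out : p.Prime).pos
  simp only [checkK, Bool.and_eq_true, List.all_eq_true, decide_eq_true_eq] at hcheck
  obtain ⟨hkeys, hcof⟩ := hcheck
  refine ⟨(splitK p (powK (withKey G) (p - 1))).map fun g => (Finsupp.equivFunOnFinite.symm g.2.1, evalK K g.2.2),
    (splitK p (powK (withKey G) (p - 1))).map fun g => evalK K (lookupRK R g.1 g.2.1), fun i => evalL K (T i), evalL K T₀,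
    splitK_nodup K p hp _ (pairwise_of_pwDistinct _ hkeys), ?_, ?_, ?_⟩
  · intro e he i
    obtain ⟨g, hg, rfl⟩ := List.mem_map.mp he
    simpa using (splitK_inv p hp _ g hg).2 i
  · rw [← evalK_withKey, ← evalK_powK, ← evalK_splitK K p]
  · have h := evalK_cofactorNFK K p (withKey G) S (splitK p (powK (withKey G) (p - 1))) R T T₀
    rw [evalK_eq_zero_of_dvd K p _ hcof, evalK_withKey] at h
    exact (sub_eq_zero.mp h.symm).symm

/-- **ALL G2 CELLS OF ONE CHART FROM ONE KERNEL CHECK** (`checkKs`: one split of `g^(p-1)`, one cofactor identity per listed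
stratum): the §3 hypothesis `∀ S ∈ SS, ∃ L rr t t₀, …` for `SS = cells.map Prod.fst`. [folklore] -/
theorem klocCells_of_check (p : ℕ) [Fact p.Prime] [CharP K p] (G : List (ℤ × (Fin n → ℕ)))
    (cells : List (Finset (Fin n) × List ((Fin n → ℕ) × List (ℤ × (Fin n → ℕ))) × (Fin n → List (ℤ × (Fin n → ℕ))) ×
      List (ℤ × (Fin n → ℕ))))
    (hcheck : checkKs p G cells = true) :
    ∀ S ∈ cells.map Prod.fst, ∃ (L : List ((Fin n →₀ ℕ) × MvPolynomial (Fin n) K)) (rr : List (MvPolynomial (Fin n) K))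
      (t : Fin n → MvPolynomial (Fin n) K) (t₀ : MvPolynomial (Fin n) K),
      (L.map Prod.fst).Nodup ∧ (∀ e ∈ L, ∀ i : Fin n, e.1 i < p) ∧
      evalL K G ^ (p - 1) = (L.map fun e => MvPolynomial.monomial e.1 (1 : K) * MvPolynomial.expand p e.2).sum ∧
      (1 : MvPolynomial (Fin n) K) = (List.zipWith (fun r e => r * MvPolynomial.expand p e.2) rr L).sum +
        ∑ i ∈ S, t i * MvPolynomial.X i + t₀ * evalL K G := by
  intro S hS
  obtain ⟨c, hc, rfl⟩ := List.mem_map.mp hS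
  simp only [checkKs, Bool.and_eq_true, List.all_eq_true, decide_eq_true_eq] at hcheck
  refine klocCell_of_check K p G c.1 c.2.1 c.2.2.1 c.2.2.2 ?_
  simp only [checkK, Bool.and_eq_true, List.all_eq_true, decide_eq_true_eq]
  exact ⟨hcheck.1, hcheck.2 c hc⟩

end Summit.ResolutionOfSingularities.ResolutionOfSingularities.Theorems.FInjectiveMacaulayfication.KLocCellKit

end
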